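import Summits.AnomalousDissipation.AnomalousDissipation.Theses.TaylorCertificates
import Literature.Analysis.FluidPDE.SteadyNavierStokes
import Literature.Analysis.FunctionSpaces.TorusCalculusProofs

/-!
# Line `bernoulli-superlevel-blowdown` — crux `TaylorCertificates.SteadyStatesLoudBounded`
# (stmt-AnomalousDissipation-13038, rank 3) — crux-plan GEN 2, 2026-08-16: NO CONCLUDING SKELETON.
# This file PROVES (no `sorry`) the three inertness lemmas behind the verdict.

**Not a skeleton — no `stub_*`, no `SteadyStatesLoudBounded_of`.** ONE file for the line: PART I is the
gen-1 seat's typed hand-over (planner-cruxplan-…-bernoulli-superlevel-0: Props `HeadWeightedWorkIdentity`,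
`PressureRecovery`, `LaminarHeadBlowdown`, `LeadingOrderLaminarData/SubLaminarData`, the voidness statements
and the proved glue `ceilingFor_of_rates` / `noLaminarRung_of_blowdown` / `noLaminarProfile_false`), re-typed
verbatim after the gate's path normalisation made the gen-2 publication overwrite it; PART II is the gen-2
seat's (planner-cruxplan-stmt-AnomalousDissipation-13038-bernoulli-superlevel-g2-0) PROVED inertness lemmas.
Line card: `Lines/bernoulli-superlevel-blowdown.md`. Gen 2 re-derived the gen-1 analysis independently and
CONFIRMS it: the forced Korobkov–Pileckas–Russo head identity

  `ν ∫ g′(B)|∇B|² + ν ∫ g(B)|ω|² = ∫ g(B)⟪f,u⟫`,  `B = ½|u|² + p`                                  (H)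

is an algebraic consequence of the steady equations at every `ν`, so it can only act as a SELECTION
PRINCIPLE on blow-down limits, and the profile sets it selects are non-empty for EVERY admissible force
(Beltrami witnesses on the laminar rung and in the sub-laminar window — gen 1 (V-lam)/(V-sub); exact quiet
Euler points on the FLOOR side — (V-dodger), PROVED below; and, NEW here, the first non-trivial constraint
past a constant-head skeleton is a theorem of first-order solvability — (V-next), PROVED below). Every
exclusion stub the lever could feed is therefore false (leading order) or inert (first order) for every
force; what would carry the crux (`NoLaminarRung` = Livšic data, `NoSubLaminarFat` ⊇ BN1 warm branches,
`FloorFor`) belongs to other lines and does not mention the head ⇒ costume ⇒ no skeleton.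

## Contents of PART II (all kernel-checked; whole file `lean check` rc 0, 0 sorry; Part I = §A–§G as published by gen 1)
* §H.0 torus-calculus helpers over `Literature.Analysis.FunctionSpaces.Torus`: chain rule `fderiv_comp_apply`,
  `fderiv_add_apply`, `fderiv_const_mul_apply`.
* §H.1 `head_eq_inv_mul`, `isSmooth_head`, `fderiv_head_apply`.
* §H.2 **Lemma A** `integral_headLevelWork_eq_zero_of_transport`: `div U = 0`, `U·∇B = ⟪F,U⟫` pointwise ⇒
  `∫ G′(B)⟪F,U⟫ = 0` for every smooth `G` (head-superlevel works in smooth-weight form; no coarea needed).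
* §H.3 **(V-dodger)** `quietEulerPoint_headLevelWork_eq_zero`: `(v·∇)v + ∇q = f` ⇒ `∫ G′(½|v|²+q)⟪f,v⟫ = 0`.
* §H.4 **(V-next)** `firstOrder_headLevelWork_eq_zero_of_lambFree`: `U₀` Lamb-free (`ω₀ × U₀ ≡ 0`, e.g. Beltrami),
  `(U₀·∇)U₁ + (U₁·∇)U₀ + ∇P₁ = F₁` ⇒ `∫ G′(⟪U₀,U₁⟫ + P₁)⟪F₁,U₀⟫ = 0` — the order-`ν⁻¹` content of (H) on a
  laminar half-branch `u = U₀/ν + νU₁ + …` (TRIAGE-r1-3 PANEL NOTE 2: `U₀ = h₊`, `F₁ = h₋` for `f_GP`).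

Disproof.lean (cdisprove v5; evidence notes only — `run/gate/evidence/**` not mounted for this seat):
`cruxWithoutNuPos_false` / `cruxWithoutNuLt_false` honoured trivially (nothing here drops `0 < ν < ν₀`; the
lemmas are `ν`-free statements about profiles); §9 `not_body_neg_laplacian_of_euler` = the branches (V-next)
follows one order further; §11 `isSteady_iff_exists_pressure` = the classical-pressure hypothesis of (V-dodger).
No landed `Negative/` lemma exists for this crux; `ledger negatives` (13037, 0204, 2979, 2984, 2859) untouched.
-/

namespace Summit.AnomalousDissipation.AnomalousDissipation.Cruxes.SteadyStatesLoudBounded.BernoulliSuperlevelBlowdown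

open MeasureTheory Filter Topology
open scoped ENNReal NNReal InnerProductSpace RealInnerProductSpace BigOperators ContDiff
open Literature.Analysis.FunctionSpaces Literature.Analysis.FluidPDE
open Summit.AnomalousDissipation.AnomalousDissipation.Theses.TaylorCertificates

set_option linter.dupNamespace false
set_option linter.unusedVariables false

noncomputable section

local notation "𝕋³" => UnitAddTorus (Fin 3)
local notation "E³" => EuclideanSpace ℝ (Fin 3)
local notation "L2T" => Lp (EuclideanSpace ℝ (Fin 3)) 2 (volume : Measure (UnitAddTorus (Fin 3)))

/-! # PART I (gen 1, planner-cruxplan-stmt-AnomalousDissipation-13038-bernoulli-superlevel-0, 2026-08-16T04:44Z;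
re-typed verbatim by the gen-2 seat after the gate's path normalisation `Lines/bernoulli-superlevel-blowdown.lean ↦
Lines/bernoulli_superlevel_blowdown.lean` made the gen-2 publication overwrite it — statements unchanged, re-checked rc 0) -/

/-! ### Gen-1 module docstring (verbatim)

**This is NOT a concluding skeleton; the seat answers `no-skeleton`.** The idea (ideator 1, card
`bernoulli-superlevel-blowdown`, merged by all three triagers with ideator 2's
`bernoulli-head-signed-work-family`; TRIAGE-r1-1/2/3: pass ×3 "as a signed tool with narrow teeth")
is the forced Korobkov–Pileckas–Russo head identity

  `ν ∫ g′(B)|∇B|² + ν ∫ g(B)|ω|² = ∫ g(B) ⟪f,u⟫`,  `B = |u|²/2 + p`,  any `C¹` weight `g`     (H)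

for smooth steady states of `NS_ν(f)` on `T³` (with `g = 1_{(k,∞)}`: the SUPERLEVEL BUDGET
`∫_{B>k} f·u = ν∫_{B>k}|ω|² + ν∫_{B=k}|∇B| ≥ 0`), and its use as blow-down data for FAT sequences
of steady states (CEILING by reductio, Leray/KPR style). The line card `Lines/bernoulli-superlevel-blowdown.md`
proves by hand, and §F below states in Lean, that EVERY leading-order datum this lever produces is
VOID FOR EVERY ADMISSIBLE FORCE — not only for `f_GP` at the two skeleton classes the triagers
examined:

* (V-lam) on the laminar rung (`lim sup ν²‖u‖² > 0`, blow-down `U = lim ν u`): for every `f ≠ 0`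
  and every curl-eigenvalue `λ` with `P_λ f ≠ 0`, the Beltrami field `U_a = a·P_λ f/‖P_λ f‖`,
  `0 < a ≤ ‖P_λ f‖/λ²`, with `P = −|U_a|²/2`, satisfies all of `LeadingOrderLaminarData f U P`
  (steady Euler with pressure, `‖∇U‖² ≤ (U,f)`, constant head ⇒ every head-weighted inequality is
  the global one) — `LaminarDataVoid`;
* (V-sub) in the sub-laminar window (`ν²‖u‖² → 0`, blow-down `V = lim u/‖u‖`): for every `f` a unit
  Beltrami field `V ∈ H_λ ∩ f^⊥` (`dim_ℝ H_{±2π} = 6` on `T³`) satisfies all of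
  `LeadingOrderSubLaminarData f V P` with equalities — `SubLaminarDataVoid`;
* (V-dodger) on the FLOOR side, at an exact quiet Euler point `v` (`(v·∇)v + ∇p = f`) one has
  `v·∇B_v = f·v`, so `∫_{B_v>k} f·v = k ∫_{B_v=k} v·n = 0` automatically.

Consequently any composition `stub₁ → … → SteadyStatesLoudBounded` must carry, as stubs, a FLOOR
lever (Lamb rigidity — line `kam-channel-rigidity-quiet-baths`), the warm sub-laminar exclusion
`C_warm` (line `kelvin-batchelor-work-coboundary`) and the NEXT-ORDER exclusion of Beltrami laminar
profiles (Livšic data; `FrustratedForces.GPSteadySubGrashof`'s foreseen split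
`BeltramiSkeletonExclusion`), on none of which the head family acts (the head is constant at every
Beltrami profile). By the crux-plan standard (every stub a genuine lemma OF THE LINE; no costume)
that is not a skeleton of this idea. The sorry-free glue of §G makes the collapse formal: the only
place content could sit is an exclusion hypothesis, and §F says its leading-order form is false.

What this file IS (typed, `lean check` rc 0, NO `sorry`): the crux split per force (§A); the head
objects in the smooth category with `|ω|²` written dimension-free as `|∇u|² − tr((∇u)²)` (§B); the
finite-`ν` identity (H) and pressure recovery as named `Prop`s — the typed FIRST LEMMA of the merged
line, provable now (§C); the `ν`-free rescaled identity (§D, remark); the laminar-rung blow-down with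
head data, typed over `Torus.energySpace` exactly like `FrustratedForces.LaminarLimitCompactness`
(§E); the two voidness statements (§F, Disproof-side targets for cdisprove); and the rate-dichotomy
glue (§G).

Disproof.lean (cdisprove v5, read through its evidence notes — the file itself is not mounted on
this hub) honoured: `cruxWithoutNuPos_false` / `cruxWithoutNuLt_false` (every statement below keeps
`0 < ν`, `ν < ν₀`); §9 `not_body_neg_laplacian_of_euler` is the `a = ‖P_λ f‖/λ²` endpoint of (V-lam)
realised exactly (force `−ΔU`, `U` Beltrami); §10 `body_smul_iff` (cone) — (V-lam)/(V-sub) are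
scale-free; §11 `isSteady_iff_exists_pressure` = `PressureRecovery` below. Negatives index
(13037, 0204, 2979, 2984, 2859): nothing here restates one (all fields mean-zero; no certificate).
-/

/-! ## §A  The crux per force: steady states, FLOOR, CEILING (definitional bookkeeping, proved) -/

/-- `u` is a steady state of `NS_ν(f)` in the crux's exact sense: smooth, divergence-free,
mean-zero, and `∫ ⟪νΔu − (u·∇)u + f, w⟫ = 0` for every smooth divergence-free mean-zero `w`
(pressure-free weak form; by Disproof §11 equivalent to the classical equations with a smooth
pressure, cf. `PressureRecovery`). -/
def IsCruxSteady (ν : ℝ) (f u : 𝕋³ → E³) : Prop :=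
  Torus.IsSmooth u ∧ Torus.IsDivFree u ∧ Torus.HasZeroMean u ∧
    ∀ w : 𝕋³ → E³, Torus.IsSmooth w → Torus.IsDivFree w → Torus.HasZeroMean w →
      ∫ x, ⟪ν • Torus.laplacian u x - Torus.convect u u x + f x, w x⟫_ℝ = 0

/-- FLOOR for the force `f`: `ν‖∇u‖² ≥ ε₀` at every steady state, `ν < ν₀`. -/
def FloorFor (f : 𝕋³ → E³) : Prop :=
  ∃ (ε₀ ν₀ : ℝ), 0 < ε₀ ∧ 0 < ν₀ ∧ ∀ ν : ℝ, 0 < ν → ν < ν₀ →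
    ∀ u : 𝕋³ → E³, IsCruxSteady ν f u → ε₀ ≤ ν * Torus.gradNormSq u

/-- CEILING for the force `f`: `‖u‖² ≤ E` at every steady state, `ν < ν₀`. -/
def CeilingFor (f : 𝕋³ → E³) : Prop :=
  ∃ (E ν₀ : ℝ), 0 < ν₀ ∧ ∀ ν : ℝ, 0 < ν → ν < ν₀ →
    ∀ u : 𝕋³ → E³, IsCruxSteady ν f u → ∫ x, ‖u x‖ ^ 2 ≤ E

/-- The crux's body for ONE force (FLOOR ∧ CEILING with a common `ν₀`). -/
def LoudBoundedFor (f : 𝕋³ → E³) : Prop :=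
  ∃ (ε₀ E ν₀ : ℝ), 0 < ε₀ ∧ 0 < ν₀ ∧ ∀ ν : ℝ, 0 < ν → ν < ν₀ →
    ∀ u : 𝕋³ → E³, IsCruxSteady ν f u → ε₀ ≤ ν * Torus.gradNormSq u ∧ ∫ x, ‖u x‖ ^ 2 ≤ E

/-- The crux, read per force (currying the four admissibility hypotheses of `u`). -/
theorem steadyStatesLoudBounded_iff :
    SteadyStatesLoudBounded ↔
      ∃ f : 𝕋³ → E³, Torus.IsSmooth f ∧ Torus.IsDivFree f ∧ Torus.HasZeroMean f ∧ LoudBoundedFor f := by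
  constructor
  · rintro ⟨f, hfs, hfd, hfz, ε₀, E, ν₀, hε₀, hν₀, h⟩
    refine ⟨f, hfs, hfd, hfz, ε₀, E, ν₀, hε₀, hν₀, fun ν hν hνlt u hu => ?_⟩
    exact h ν hν hνlt u hu.1 hu.2.1 hu.2.2.1 hu.2.2.2
  · rintro ⟨f, hfs, hfd, hfz, ε₀, E, ν₀, hε₀, hν₀, h⟩
    refine ⟨f, hfs, hfd, hfz, ε₀, E, ν₀, hε₀, hν₀, fun ν hν hνlt u hus hud huz huw => ?_⟩
    exact h ν hν hνlt u ⟨hus, hud, huz, huw⟩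

/-- FLOOR ∧ CEILING ⇔ the crux body, per force (take the smaller `ν₀`). -/
theorem loudBoundedFor_iff (f : 𝕋³ → E³) : LoudBoundedFor f ↔ FloorFor f ∧ CeilingFor f := by
  constructor
  · rintro ⟨ε₀, E, ν₀, hε₀, hν₀, h⟩
    exact ⟨⟨ε₀, ν₀, hε₀, hν₀, fun ν hν hνlt u hu => (h ν hν hνlt u hu).1⟩,
      ⟨E, ν₀, hν₀, fun ν hν hνlt u hu => (h ν hν hνlt u hu).2⟩⟩
  · rintro ⟨⟨ε₀, ν₁, hε₀, hν₁, hF⟩, ⟨E, ν₂, hν₂, hC⟩⟩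
    refine ⟨ε₀, E, min ν₁ ν₂, hε₀, lt_min hν₁ hν₂, fun ν hν hνlt u hu => ⟨?_, ?_⟩⟩
    · exact hF ν hν (lt_of_lt_of_le hνlt (min_le_left _ _)) u hu
    · exact hC ν hν (lt_of_lt_of_le hνlt (min_le_right _ _)) u hu

/-- The crux from ONE force carrying both clauses (how any concluding skeleton must end). -/
theorem steadyStatesLoudBounded_of_force {f : 𝕋³ → E³} (hfs : Torus.IsSmooth f)
    (hfd : Torus.IsDivFree f) (hfz : Torus.HasZeroMean f) (hF : FloorFor f) (hC : CeilingFor f) :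
    SteadyStatesLoudBounded :=
  steadyStatesLoudBounded_iff.2 ⟨f, hfs, hfd, hfz, (loudBoundedFor_iff f).2 ⟨hF, hC⟩⟩

/-! ## §B  Head objects (smooth category) -/

/-- The total head (Bernoulli pressure) `B = |u|²/2 + p`. -/
def head (u : 𝕋³ → E³) (p : 𝕋³ → ℝ) : 𝕋³ → ℝ :=
  fun x => ‖u x‖ ^ 2 / 2 + p x

/-- `|ω|² = |curl u|²` written dimension-free and pointwise as `|∇u|² − tr((∇u)²)`
(`Σᵢ‖∂ᵢu‖² − Σᵢⱼ (∂ᵢu)ⱼ(∂ⱼu)ᵢ`; no solenoidality needed for this pointwise identity). -/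
def vortSq (u : 𝕋³ → E³) (x : 𝕋³) : ℝ :=
  (∑ i, ‖Torus.partialDeriv i u x‖ ^ 2) -
    ∑ i, ∑ j, (Torus.partialDeriv i u x) j * (Torus.partialDeriv j u x) i

/-- `|∇B|²` of a scalar. -/
def gradSq (B : 𝕋³ → ℝ) (x : 𝕋³) : ℝ :=
  ∑ i, (Torus.partialDeriv i B x) ^ 2

/-- The classical steady equations with a pressure: `(u·∇)u + ∇p = νΔu + f` pointwise. -/
def SolvesSteadyNS (ν : ℝ) (f u : 𝕋³ → E³) (p : 𝕋³ → ℝ) : Prop :=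
  ∀ x, Torus.convect u u x + Torus.gradient p x = ν • Torus.laplacian u x + f x

/-! ## §C  The lever at finite viscosity: the head-weighted work identity (H) and pressure recovery -/

/-- **(H) `HeadWeightedWorkIdentity` — the typed FIRST LEMMA of the merged line (provable now).**
For `ν > 0`, `f` smooth and DIVERGENCE-FREE, a smooth divergence-free `u` and a smooth `p` solving
`(u·∇)u + ∇p = νΔu + f`, and ANY `C¹` weight `g : ℝ → ℝ`:
`ν ∫ g′(B)|∇B|² + ν ∫ g(B)|ω|² = ∫ g(B)⟪f,u⟫`, `B = |u|²/2 + p`.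
PROOF (one page): `u·∇B = ⟪u,(u·∇)u⟫ + u·∇p = ν⟪u,Δu⟫ + ⟪f,u⟫`; `ΔB = |∇u|² + ⟪u,Δu⟫ + Δp` and
`Δp = div f − ∂ᵢuⱼ∂ⱼuᵢ = −∂ᵢuⱼ∂ⱼuᵢ` (divergence of the equation, `div u = div f = 0`), so with
`|ω|² = |∇u|² − ∂ᵢuⱼ∂ⱼuᵢ` the HEAD EQUATION `u·∇B − νΔB = ⟪f,u⟫ − ν|ω|²` holds pointwise; multiply
by `g(B)`, integrate over `T³`: `∫ g(B) u·∇B = ∫ u·∇(G∘B) = 0` (`G′ = g`, `div u = 0`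
[gen 2: = Lemma A of Part II]) and `−ν∫ g(B)ΔB = ν∫ g′(B)|∇B|²` (integration by parts on the torus,
`Torus.laplacian` / `Torus.partialDeriv` calculus of `TorusCalculus`). With `g ≥ 0` nondecreasing
both left terms are `≥ 0`: the SIGNED WORK FAMILY `∫ g(B)⟪f,u⟫ ≥ ν∫ g(B)|ω|² ≥ 0`; with
`g ↑ 1_{(k,∞)}` and the coarea formula (not in Mathlib) the SUPERLEVEL BUDGET
`∫_{B>k}⟪f,u⟫ = ν∫_{B>k}|ω|² + ν∫_{B=k}|∇B| ≥ 0`. It is the `μ = g(B)dx` instance of the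
invariant-measure work law of line `kelvin-batchelor-work-coboundary` only formally (those `μ` are
invariant for `u`'s own flow; `B` is not a first integral at `ν > 0`: `u·∇B = ν⟪u,Δu⟫ + ⟪f,u⟫`).
Sources: Korobkov–Pileckas–Russo, Ann. of Math. 181 (2015) §3 (head-pressure identities for Leray's
problem, no force); TRIAGE-r1-1 F5 / r1-2 S4 / r1-3 F3 (independent re-derivations with the force kept). -/
def HeadWeightedWorkIdentity : Prop :=
  ∀ (ν : ℝ) (f u : 𝕋³ → E³) (p : 𝕋³ → ℝ) (g : ℝ → ℝ),
    0 < ν → Torus.IsSmooth f → Torus.IsDivFree f →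
    Torus.IsSmooth u → Torus.IsDivFree u → Torus.IsSmooth p → SolvesSteadyNS ν f u p →
    ContDiff ℝ 1 g →
    ν * ∫ x, deriv g (head u p x) * gradSq (head u p) x +
        ν * ∫ x, g (head u p x) * vortSq u x =
      ∫ x, g (head u p x) * ⟪f x, u x⟫_ℝ

/-- **`PressureRecovery` (provable now; = Disproof §11 `isSteady_iff_exists_pressure`, forward).**
A steady state in the crux's pressure-free sense has a smooth pressure with which it solves the
equations classically: the residual `νΔu − (u·∇)u + f` is smooth, has zero mean (each term does,
`div u = 0`) and is `L²`-orthogonal to every smooth solenoidal mean-zero field, hence is a gradient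
by the smooth Helmholtz decomposition (`Torus.smooth_helmholtz_holds`). -/
def PressureRecovery : Prop :=
  ∀ (ν : ℝ) (f u : 𝕋³ → E³), Torus.IsSmooth f → Torus.IsDivFree f → IsCruxSteady ν f u →
    ∃ p : 𝕋³ → ℝ, Torus.IsSmooth p ∧ SolvesSteadyNS ν f u p

/-! ## §D  Remark: the `ν`-free rescaled identity

For `U := ν u`, `P := ν² p` one has `ν²ΔU − (U·∇)U + ν² f = ∇P` and, choosing the weight
`G(B) = ν⁻² G̃(ν² B)`, identity (H) becomes
`∫ g̃′(B_U)|∇B_U|² + ∫ g̃(B_U)|curl U|² = ∫ g̃(B_U)⟪f,U⟫`, `B_U = |U|²/2 + P` — NO `ν` LEFT.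
With `g̃ ≡ 1`: `‖∇U‖² = (f,U) ≤ ‖f‖‖U‖`, the uniform `H¹` bound of the laminar-normalised steady set
(Hoang–Jolly `‖v_n‖ ≤ |g|`); with `g̃′ = h′² ≥ 0`: `‖∇(h∘B_U)‖² ≤ (sup g̃)‖f‖²/4π²` — the head of the
rescaled states is uniformly `H¹` on bounded-head regions, i.e. the Lamb vector `U × ω_U = ∇B_U −
ν²(ΔU + f)` is uniformly square-integrable there. This is the one piece of extra COMPACTNESS the lever adds to
`LaminarLimitCompactness`; it excludes no Beltrami profile (Lamb vector `0`). -/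

/-! ## §E  Blow-down on the laminar rung with head data (typed like `FrustratedForces.LaminarLimitCompactness`) -/

/-- **Leading-order laminar-rung profile data** for `(f, U, P)`: everything the blow-down of a
laminar-rung fat sequence (`U = lim νₙuₙ` strongly in `L²`, `‖U‖ ≥ a > 0`) yields AT LEADING ORDER,
head family included — `U ∈ V ∖ {0}` is a steady weak Euler flow (`IsSteadyWeakSolution 0 0`) with
an integrable pressure `P` (`div(U⊗U) + ∇P = 0` weakly: `∫ ⟪U,(U·∇)w⟫ + P div w = 0` for all smooth
`w`), the energy–work inequality `‖∇U‖² ≤ (U,f)` (lower semicontinuity in `‖∇Uₙ‖² = (f,Uₙ)`), and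
NON-NEGATIVE WORK ON EVERY HEAD SUPERLEVEL: `0 ≤ ∫ g(|U|²/2 + P)⟪f,U⟫` for every bounded continuous
nondecreasing `g ≥ 0` (limit of the signed family of (H) after §D; the `∫ g(B)|curl U|²` term,
which also survives as a lower bound, is omitted only because the tree has no weak curl on `V`). -/
def LeadingOrderLaminarData (f : 𝕋³ → E³) (U : Torus.energySpace (Fin 3)) (P : 𝕋³ → ℝ) : Prop :=
  U ≠ 0 ∧ (U : L2T) ∈ Torus.energySpaceV (Fin 3) ∧ Torus.IsSteadyWeakSolution 0 0 U ∧
  Integrable P volume ∧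
  (∀ w : 𝕋³ → E³, Torus.IsSmooth w →
    ∫ x, (⟪((U : L2T) : 𝕋³ → E³) x, Torus.convect ((U : L2T) : 𝕋³ → E³) w x⟫_ℝ +
      P x * Torus.divergence w x) = 0) ∧
  (Torus.eGradNormSq ((U : L2T) : 𝕋³ → E³)).toReal ≤ Torus.pairing (U : L2T) f ∧
  ∀ g : ℝ → ℝ, Continuous g → Monotone g → (∀ t, 0 ≤ g t) → (∃ M : ℝ, ∀ t, g t ≤ M) →
    0 ≤ ∫ x, g (‖((U : L2T) : 𝕋³ → E³) x‖ ^ 2 / 2 + P x) * ⟪f x, ((U : L2T) : 𝕋³ → E³) x⟫_ℝ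

/-- **`LaminarHeadBlowdown` (M–L, plausibly provable: Rellich on `T³`, pressure by `Δ⁻¹ div div`,
lower semicontinuity; the genuine analytic lemma of the idea).** Steady states `uₙ` of `NS_{νₙ}(f)`
with pressures `pₙ`, `νₙ → 0`, on the LAMINAR RUNG `νₙ²‖uₙ‖² ≥ a² > 0`: a subsequence of `νₙuₙ`
converges strongly in `L²` to some `U ∈ H` with `‖U‖ ≥ a` carrying `LeadingOrderLaminarData`. -/
def LaminarHeadBlowdown : Prop :=
  ∀ f : 𝕋³ → E³, Torus.IsSmooth f → Torus.IsDivFree f → Torus.HasZeroMean f →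
  ∀ (ν : ℕ → ℝ) (u : ℕ → 𝕋³ → E³) (p : ℕ → 𝕋³ → ℝ) (a : ℝ),
    (∀ n, 0 < ν n) → Tendsto ν atTop (𝓝 0) → 0 < a →
    (∀ n, IsCruxSteady (ν n) f (u n) ∧ Torus.IsSmooth (p n) ∧ SolvesSteadyNS (ν n) f (u n) (p n)) →
    (∀ n, a ^ 2 ≤ ν n ^ 2 * ∫ x, ‖u n x‖ ^ 2) →
    ∃ (φ : ℕ → ℕ) (U : Torus.energySpace (Fin 3)) (P : 𝕋³ → ℝ), StrictMono φ ∧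
      Tendsto (fun n => ∫ x, ‖ν (φ n) • u (φ n) x - ((U : L2T) : 𝕋³ → E³) x‖ ^ 2) atTop (𝓝 0) ∧
      a ≤ ‖U‖ ∧ LeadingOrderLaminarData f U P

/-- What a CEILING-by-blow-down skeleton would need on the laminar rung: NO profile. -/
def NoLaminarProfile (f : 𝕋³ → E³) : Prop :=
  ∀ (U : Torus.energySpace (Fin 3)) (P : 𝕋³ → ℝ), ¬ LeadingOrderLaminarData f U P

/-! ## §F  Voidness: the leading-order data are satisfied for EVERY force (why there is no skeleton) -/

/-- **(V-lam) `LaminarDataVoid` — every non-zero admissible force has a leading-order laminar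
profile.** PROOF (card §3.1): `f ≠ 0` smooth solenoidal mean-zero has a non-zero curl-eigencomponent
`P_λ f` (`λ = ±2π|k|` on some shell; the helical projections are smooth, solenoidal, mean-zero and
span). `W := P_λ f/‖P_λ f‖` is Beltrami (`curl W = λW`), hence `(W·∇)W = ∇(|W|²/2)`: steady Euler
with pressure `−|W|²/2`. Put `U := aW`, `P := −a²|W|²/2`, `0 < a ≤ ‖P_λ f‖/λ²`. Then `U ∈ V ∖ {0}`;
the pressure identity and `IsSteadyWeakSolution 0 0 U` hold classically; `‖∇U‖² = λ²a² ≤ a‖P_λ f‖ =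
(U, f)` (orthogonality of the helical sectors); and the head `|U|²/2 + P ≡ 0` is CONSTANT, so for
every weight `∫ g(B)⟪f,U⟫ = g(0)(f,U) = g(0) a‖P_λ f‖ ≥ 0`. (Even the omitted curl term passes:
`∫ g(B)|curl U|² = g(0)λ²a² ≤ g(0)a‖P_λ f‖`; and the equality `‖∇U‖² = (U,f)` of a strongly
`H¹`-convergent blow-down is met at the endpoint `a = ‖P_λ f‖/λ²`, which Disproof §9 realises
exactly for the force `−ΔU`.) Hence `NoLaminarProfile f` is FALSE for every `f ≠ 0`: the laminar
rung is a NEXT-ORDER problem (`f − λ²aU ∈ cl Ran L_U`, Livšic/cokernel data at Beltrami skeletons —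
`FrustratedForces.GPSteadySubGrashof`, kit j012495), where the head family is inert (`B ≡ const`)
[gen 2: and inert at first order as well — Part II (V-next)]. -/
def LaminarDataVoid : Prop :=
  ∀ f : 𝕋³ → E³, Torus.IsSmooth f → Torus.IsDivFree f → Torus.HasZeroMean f →
    0 < ∫ x, ‖f x‖ ^ 2 →
    ∃ (U : Torus.energySpace (Fin 3)) (P : 𝕋³ → ℝ), LeadingOrderLaminarData f U P

/-- **Leading-order SUB-LAMINAR profile data** (`ν²‖uₙ‖² → 0`, `V = lim uₙ/‖uₙ‖` strongly in `L²`,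
work `o(‖uₙ‖)`), in their STRONGEST form: unit energy, steady weak Euler with integrable pressure,
ZERO total work `(V,f) = 0` and ZERO work on every head level, `∫ g(|V|²/2 + P)⟪f,V⟫ = 0` for every
bounded continuous `g` (the card's "zero work of `f` on every Bernoulli superlevel set of the Euler
profile"). -/
def LeadingOrderSubLaminarData (f : 𝕋³ → E³) (V : Torus.energySpace (Fin 3)) (P : 𝕋³ → ℝ) : Prop :=
  ‖V‖ = 1 ∧ Torus.IsSteadyWeakSolution 0 0 V ∧ Integrable P volume ∧
  (∀ w : 𝕋³ → E³, Torus.IsSmooth w →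
    ∫ x, (⟪((V : L2T) : 𝕋³ → E³) x, Torus.convect ((V : L2T) : 𝕋³ → E³) w x⟫_ℝ +
      P x * Torus.divergence w x) = 0) ∧
  Torus.pairing (V : L2T) f = 0 ∧
  ∀ g : ℝ → ℝ, Continuous g → (∃ M : ℝ, ∀ t, |g t| ≤ M) →
    ∫ x, g (‖((V : L2T) : 𝕋³ → E³) x‖ ^ 2 / 2 + P x) * ⟪f x, ((V : L2T) : 𝕋³ → E³) x⟫_ℝ = 0

/-- **(V-sub) `SubLaminarDataVoid` — every admissible force has a leading-order sub-laminar
profile, even in the equality form.** PROOF (card §3.2): the real curl-eigenspace `H_{2π}` of the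
first shell of `T³` is `6`-dimensional (the ABC family with phases), so it contains a unit `V` with
`(V, f) = (V, P_{2π} f) = 0`. `V` is Beltrami ⇒ steady Euler with `P = −|V|²/2`, constant head
`B ≡ 0`, whence `∫ g(B)⟪f,V⟫ = g(0)(f,V) = 0` for every `g`. (Invisible oblique shears
`φ(k·x)d` do the same for every BAND-LIMITED `f` — TRIAGE S2/F2 — but the Beltrami witness needs no
band limit.) Hence a typed "no sub-laminar profile" stub is FALSE for every force; the sub-laminar
window (BN1 warm branches `E ≍ ν^{-2/3}`) is decided only at finite `ν`, next order. -/
def SubLaminarDataVoid : Prop :=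
  ∀ f : 𝕋³ → E³, Torus.IsSmooth f → Torus.IsDivFree f → Torus.HasZeroMean f →
    ∃ (V : Torus.energySpace (Fin 3)) (P : 𝕋³ → ℝ), LeadingOrderSubLaminarData f V P

/-- Voidness kills the exclusion stub, for every non-zero force (one line). -/
theorem noLaminarProfile_false (hV : LaminarDataVoid) {f : 𝕋³ → E³} (hfs : Torus.IsSmooth f)
    (hfd : Torus.IsDivFree f) (hfz : Torus.HasZeroMean f) (hf0 : 0 < ∫ x, ‖f x‖ ^ 2) :
    ¬ NoLaminarProfile f := by
  intro hno
  obtain ⟨U, P, hUP⟩ := hV f hfs hfd hfz hf0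
  exact hno U P hUP

/-! ## §G  The rate-dichotomy glue a CEILING-by-blow-down skeleton would use (pure logic, proved) -/

/-- No laminar rung for `f`: `ν²‖u‖² → 0` uniformly over steady states (the shape of
`FrustratedForces.GPSteadySubGrashof`, here over the crux's smooth steady states). -/
def NoLaminarRung (f : 𝕋³ → E³) : Prop :=
  ∀ c : ℝ, 0 < c → ∃ ν₁ : ℝ, 0 < ν₁ ∧ ∀ ν : ℝ, 0 < ν → ν < ν₁ →
    ∀ u : 𝕋³ → E³, IsCruxSteady ν f u → ν ^ 2 * ∫ x, ‖u x‖ ^ 2 ≤ c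

/-- No sub-laminar fat window for `f`: beyond some energy `E₁`, steady states are at least
laminar-fat, `ν²‖u‖² ≥ c` (ideator 2's `NoFatWindow`; this is where the warm branch BN1 lives and
where `C_warm` of line `kelvin-batchelor-work-coboundary` would have to be proved). -/
def NoSubLaminarFat (f : 𝕋³ → E³) : Prop :=
  ∃ (c E₁ ν₁ : ℝ), 0 < c ∧ 0 < ν₁ ∧ ∀ ν : ℝ, 0 < ν → ν < ν₁ →
    ∀ u : 𝕋³ → E³, IsCruxSteady ν f u → E₁ < ∫ x, ‖u x‖ ^ 2 → c ≤ ν ^ 2 * ∫ x, ‖u x‖ ^ 2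

/-- Rate dichotomy: no laminar rung and no sub-laminar window give the CEILING (no sequences
needed: at `ν` below both thresholds a state above `E₁` would be laminar-fat and sub-`c/2` at once). -/
theorem ceilingFor_of_rates {f : 𝕋³ → E³} (hL : NoLaminarRung f) (hS : NoSubLaminarFat f) :
    CeilingFor f := by
  obtain ⟨c, E₁, ν₁, hc, hν₁, hS⟩ := hS
  obtain ⟨ν₂, hν₂, hL⟩ := hL (c / 2) (half_pos hc)
  refine ⟨E₁, min ν₁ ν₂, lt_min hν₁ hν₂, fun ν hν hνlt u hu => ?_⟩
  by_contra hE
  push Not at hE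
  have h1 := hS ν hν (lt_of_lt_of_le hνlt (min_le_left _ _)) u hu hE
  have h2 := hL ν hν (lt_of_lt_of_le hνlt (min_le_right _ _)) u hu
  linarith

/-- How the idea's lemmas would enter: blow-down plus an EXCLUSION hypothesis give `NoLaminarRung`
(by contradiction along `νₙ < 1/(n+1)`; pressures from `PressureRecovery`). All content sits in the
exclusion hypothesis `NoLaminarProfile f` — and `noLaminarProfile_false` says it fails for every
`f ≠ 0`. This theorem is the formal statement of the collapse recorded in the line card. -/
theorem noLaminarRung_of_blowdown (hP : PressureRecovery) (hB : LaminarHeadBlowdown) {f : 𝕋³ → E³}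
    (hfs : Torus.IsSmooth f) (hfd : Torus.IsDivFree f) (hfz : Torus.HasZeroMean f)
    (hno : NoLaminarProfile f) : NoLaminarRung f := by
  intro c hc
  by_contra hcon
  push Not at hcon
  -- for every threshold `ν₁ > 0` there is a steady state below it with `ν²‖u‖² > c`
  have key : ∀ n : ℕ, ∃ ν : ℝ, 0 < ν ∧ ν < 1 / ((n : ℝ) + 1) ∧
      ∃ u : 𝕋³ → E³, IsCruxSteady ν f u ∧ c < ν ^ 2 * ∫ x, ‖u x‖ ^ 2 := by
    intro n
    have hpos : (0 : ℝ) < 1 / ((n : ℝ) + 1) := by positivity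
    obtain ⟨ν, hν, hνlt, u, hu, hcu⟩ := hcon (1 / ((n : ℝ) + 1)) hpos
    exact ⟨ν, hν, hνlt, u, hu, hcu⟩
  choose ν hν hνlt u hu hcu using key
  have hp : ∀ n, ∃ p : 𝕋³ → ℝ, Torus.IsSmooth p ∧ SolvesSteadyNS (ν n) f (u n) p :=
    fun n => hP (ν n) f (u n) hfs hfd (hu n)
  choose p hps hpe using hp
  have hνto : Tendsto ν atTop (𝓝 0) := by
    have h1 : Tendsto (fun n : ℕ => 1 / ((n : ℝ) + 1)) atTop (𝓝 0) :=
      tendsto_one_div_add_atTop_nhds_zero_nat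
    refine squeeze_zero (fun n => (hν n).le) (fun n => (hνlt n).le) h1
  have ha : ∀ n, Real.sqrt c ^ 2 ≤ ν n ^ 2 * ∫ x, ‖u n x‖ ^ 2 := by
    intro n
    rw [Real.sq_sqrt hc.le]
    exact (hcu n).le
  obtain ⟨φ, U, P, -, -, -, hdata⟩ :=
    hB f hfs hfd hfz ν u p (Real.sqrt c) hν hνto (Real.sqrt_pos.2 hc)
      (fun n => ⟨hu n, hps n, hpe n⟩) ha
  exact hno U P hdata


/-! # PART II (gen 2, planner-cruxplan-stmt-AnomalousDissipation-13038-bernoulli-superlevel-g2-0, 2026-08-16):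
the inertness lemmas, PROVED — Lemma A (transport ⇒ zero head-level work), (V-dodger), (V-next) -/

/-! ## §H.0  Torus-calculus helpers (chain rule, additivity, constant multiples) -/

/-- Chain rule on the torus: `D(G ∘ B)(x) w = G′(B x) · DB(x) w` for `C¹` scalar `B` and `C¹` `G`. -/
theorem fderiv_comp_apply {B : 𝕋³ → ℝ} {G : ℝ → ℝ} (hB : Torus.IsContDiff 1 B)
    (hG : ContDiff ℝ 1 G) (x : 𝕋³) (w : E³) :
    Torus.fderiv (G ∘ B) x w = deriv G (B x) * Torus.fderiv B x w := by
  have hdB : DifferentiableAt ℝ (Torus.liftAt B x) 0 :=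
    ((hB.liftAt x).differentiable one_ne_zero).differentiableAt
  have hdG : DifferentiableAt ℝ G (Torus.liftAt B x 0) :=
    (hG.differentiable one_ne_zero).differentiableAt
  have h : Torus.liftAt (G ∘ B) x = G ∘ Torus.liftAt B x := rfl
  have hc : HasFDerivAt (G ∘ Torus.liftAt B x)
      (deriv G (Torus.liftAt B x 0) • fderiv ℝ (Torus.liftAt B x) 0) 0 :=
    hdG.hasDerivAt.comp_hasFDerivAt (0 : E³) hdB.hasFDerivAt
  show _root_.fderiv ℝ (Torus.liftAt (G ∘ B) x) 0 w = deriv G (B x) * _root_.fderiv ℝ (Torus.liftAt B x) 0 w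
  rw [h, hc.fderiv]
  show deriv G (Torus.liftAt B x 0) * _root_.fderiv ℝ (Torus.liftAt B x) 0 w = _
  rw [Torus.liftAt_apply_zero]

/-- Additivity of the torus derivative for `C¹` scalar functions. -/
theorem fderiv_add_apply {a b : 𝕋³ → ℝ} (ha : Torus.IsContDiff 1 a) (hb : Torus.IsContDiff 1 b)
    (x : 𝕋³) (w : E³) :
    Torus.fderiv (fun y => a y + b y) x w = Torus.fderiv a x w + Torus.fderiv b x w := by
  have hda : DifferentiableAt ℝ (Torus.liftAt a x) 0 :=
    ((ha.liftAt x).differentiable one_ne_zero).differentiableAt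
  have hdb : DifferentiableAt ℝ (Torus.liftAt b x) 0 :=
    ((hb.liftAt x).differentiable one_ne_zero).differentiableAt
  have h : Torus.liftAt (fun y => a y + b y) x = Torus.liftAt a x + Torus.liftAt b x := rfl
  show _root_.fderiv ℝ (Torus.liftAt (fun y => a y + b y) x) 0 w =
    _root_.fderiv ℝ (Torus.liftAt a x) 0 w + _root_.fderiv ℝ (Torus.liftAt b x) 0 w
  rw [h, (hda.hasFDerivAt.add hdb.hasFDerivAt).fderiv]
  rfl

/-- Constant multiples pass through the torus derivative (`C¹` scalar functions). -/
theorem fderiv_const_mul_apply {a : 𝕋³ → ℝ} (ha : Torus.IsContDiff 1 a) (c : ℝ) (x : 𝕋³) (w : E³) :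
    Torus.fderiv (fun y => c * a y) x w = c * Torus.fderiv a x w := by
  have hda : DifferentiableAt ℝ (Torus.liftAt a x) 0 :=
    ((ha.liftAt x).differentiable one_ne_zero).differentiableAt
  have h : Torus.liftAt (fun y => c * a y) x = fun v => c * Torus.liftAt a x v := rfl
  show _root_.fderiv ℝ (Torus.liftAt (fun y => c * a y) x) 0 w = c * _root_.fderiv ℝ (Torus.liftAt a x) 0 w
  rw [h, (hda.hasFDerivAt.const_mul c).fderiv]
  rfl

/-! ## §H.1  The head of §B and its derivative -/

/-- The head of §B in the form `2⁻¹·|u|² + p` used by the derivative helpers. -/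
theorem head_eq_inv_mul (u : 𝕋³ → E³) (p : 𝕋³ → ℝ) :
    head u p = fun x => 2⁻¹ * ‖u x‖ ^ 2 + p x := by
  funext x
  simp only [head]
  ring

theorem isSmooth_head {u : 𝕋³ → E³} {p : 𝕋³ → ℝ} (hu : Torus.IsSmooth u) (hp : Torus.IsSmooth p) :
    Torus.IsSmooth (head u p) := by
  rw [head_eq_inv_mul]
  exact (contDiff_const.mul hu.norm_sq).add hp

/-- `DB(x) w = ⟪u x, Du(x) w⟫ + Dp(x) w` for the head `B = ½|u|² + p`. -/
theorem fderiv_head_apply {u : 𝕋³ → E³} {p : 𝕋³ → ℝ} (hu : Torus.IsSmooth u)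
    (hp : Torus.IsSmooth p) (x : 𝕋³) (w : E³) :
    Torus.fderiv (head u p) x w = ⟪u x, Torus.fderiv u x w⟫_ℝ + Torus.fderiv p x w := by
  have hu1 : Torus.IsContDiff 1 u := hu.isContDiff (by simp)
  have hp1 : Torus.IsContDiff 1 p := hp.isContDiff (by simp)
  have hn : Torus.IsSmooth (fun y => ‖u y‖ ^ 2) := hu.norm_sq
  have hn1 : Torus.IsContDiff 1 (fun y => ‖u y‖ ^ 2) := hn.isContDiff (by simp)
  have hcn : Torus.IsSmooth (fun y => (2 : ℝ)⁻¹ * ‖u y‖ ^ 2) := contDiff_const.mul hn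
  have hcn1 : Torus.IsContDiff 1 (fun y => (2 : ℝ)⁻¹ * ‖u y‖ ^ 2) := hcn.isContDiff (by simp)
  rw [head_eq_inv_mul, fderiv_add_apply hcn1 hp1, fderiv_const_mul_apply hn1,
    Torus.fderiv_norm_sq_apply hu1]
  ring

/-! ## §H.2  Lemma A — transport of the head kills every head-level work integral -/

/-- **Lemma A (head-level work vanishes under transport).** If `U` is smooth and divergence free,
`B` smooth, and the work density `⟪F, U⟫` is the `U`-derivative of `B` (`U·∇B = F·U` pointwise), then
for every smooth `G : ℝ → ℝ` the `G′(B)`-weighted work of `F` on `U` vanishes: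
`∫ G′(B) ⟪F, U⟫ = ∫ U·∇(G ∘ B) = −∫ (div U) (G ∘ B) = 0`. With `G′ ↑ 1_{(k,∞)}` these are the works
of `F` on the head superlevel sets `{B > k}` (the objects of the idea card). -/
theorem integral_headLevelWork_eq_zero_of_transport
    {U F : 𝕋³ → E³} {B : 𝕋³ → ℝ} {G : ℝ → ℝ}
    (hU : Torus.IsSmooth U) (hdiv : Torus.IsDivFree U) (hB : Torus.IsSmooth B)
    (hG : ContDiff ℝ ∞ G)
    (htr : ∀ x, Torus.fderiv B x (U x) = ⟪F x, U x⟫_ℝ) :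
    ∫ x, deriv G (B x) * ⟪F x, U x⟫_ℝ = 0 := by
  have hGB : Torus.IsSmooth (G ∘ B) := hG.comp hB
  have key : ∀ x, deriv G (B x) * ⟪F x, U x⟫_ℝ = Torus.fderiv (G ∘ B) x (U x) := by
    intro x
    rw [← htr x, fderiv_comp_apply (hB.isContDiff (by simp)) (hG.of_le (by simp)) x (U x)]
  simp_rw [key]
  exact Torus.integral_fderiv_apply_eq_zero_of_isDivFree hU hGB hdiv

/-! ## §H.3  (V-dodger) Quiet Euler points pass every head constraint -/

/-- **(V-dodger).** At an exact steady Euler flow `v` driven by `f` (`(v·∇)v + ∇q = f` classically,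
`v` smooth solenoidal) every head-level work of `f` vanishes: `∫ G′(B_v)⟪f, v⟫ = 0`,
`B_v = ½|v|² + q`, for every smooth `G` — because `v·∇B_v = ⟪v,(v·∇)v⟫ + v·∇q = ⟪f, v⟫`.
The FLOOR enemy of the crux (quiet branches `u_ν → v`) is invisible to the lever. -/
theorem quietEulerPoint_headLevelWork_eq_zero
    {v f : 𝕋³ → E³} {q : 𝕋³ → ℝ} {G : ℝ → ℝ}
    (hv : Torus.IsSmooth v) (hdiv : Torus.IsDivFree v) (hq : Torus.IsSmooth q)
    (hG : ContDiff ℝ ∞ G)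
    (hE : ∀ x, Torus.convect v v x + Torus.gradient q x = f x) :
    ∫ x, deriv G (head v q x) * ⟪f x, v x⟫_ℝ = 0 := by
  refine integral_headLevelWork_eq_zero_of_transport hv hdiv (isSmooth_head hv hq) hG fun x => ?_
  rw [fderiv_head_apply hv hq, ← hE x, inner_add_left, Torus.inner_gradient_left]
  simp only [Torus.convect]
  linarith [real_inner_comm (v x) (Torus.fderiv v x (v x))]

/-! ## §H.4  (V-next) First order past a constant-head skeleton: the head family is still inert -/

/-- **(V-next) — first-order inertness at constant-head (generalised Beltrami) skeletons.**
Let `U₀` be smooth and solenoidal with vanishing Lamb vector, `ω₀ × U₀ ≡ 0`, written without a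
curl as `⟪(U₀·∇)U₀, w⟫ = ⟪(w·∇)U₀, U₀⟫` for all `w` (equivalently `(U₀·∇)U₀ = ∇(½|U₀|²)`: `U₀` is a
steady Euler flow with CONSTANT head — every curl eigenfield / ABC flow). Let `(U₁, P₁)` solve the
linearised steady Euler equations at `U₀` with forcing `F₁`,
`(U₀·∇)U₁ + (U₁·∇)U₀ + ∇P₁ = F₁`, and let `B₁ = ⟪U₀, U₁⟫ + P₁` be the first-order head. Then
`U₀·∇B₁ = ⟪F₁, U₀⟫` pointwise (the two `½ D|U₀|²[U₁]` terms cancel), hence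
`∫ G′(B₁)⟪F₁, U₀⟫ = 0` for every smooth `G`.
READING: on a laminar half-branch `u = U₀/ν + νU₁ + …` of `NS_ν(f)` (`U₀` Beltrami, `F₁ = f + ΔU₀`;
TRIAGE-r1-3 PANEL NOTE 2 for `f_GP`: `U₀ = h₊`, `F₁ = h₋`) the head identity (H) at order `ν⁻¹`
reads `∫ g(B₁)⟪f, U₀⟫ = ∫ g(B₁)|curl U₀|²`, i.e. `∫ g(B₁)⟪F₁, U₀⟫ = 0` since
`|curl U₀|² + ⟪ΔU₀, U₀⟫ = 0` pointwise for Beltrami `U₀` — exactly this theorem. So the first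
non-trivial head constraint past a Beltrami skeleton is a consequence of first-order SOLVABILITY
alone: the lever cannot obstruct the corrector; only the Livšic/cokernel data of `L_{U₀}` can
(FrustratedForces.GPSteadySubGrashof's business), and they do not mention the head. -/
theorem firstOrder_headLevelWork_eq_zero_of_lambFree
    {U₀ U₁ F₁ : 𝕋³ → E³} {P₁ : 𝕋³ → ℝ} {G : ℝ → ℝ}
    (h₀ : Torus.IsSmooth U₀) (hdiv : Torus.IsDivFree U₀) (h₁ : Torus.IsSmooth U₁)
    (hP : Torus.IsSmooth P₁) (hG : ContDiff ℝ ∞ G)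
    (hlamb : ∀ (x : 𝕋³) (w : E³), ⟪Torus.convect U₀ U₀ x, w⟫_ℝ = ⟪Torus.fderiv U₀ x w, U₀ x⟫_ℝ)
    (hlin : ∀ x, Torus.convect U₀ U₁ x + Torus.convect U₁ U₀ x + Torus.gradient P₁ x = F₁ x) :
    ∫ x, deriv G (⟪U₀ x, U₁ x⟫_ℝ + P₁ x) * ⟪F₁ x, U₀ x⟫_ℝ = 0 := by
  have hB : Torus.IsSmooth (fun y => ⟪U₀ y, U₁ y⟫_ℝ + P₁ y) := (h₀.inner h₁).add hP
  refine integral_headLevelWork_eq_zero_of_transport (B := fun y => ⟪U₀ y, U₁ y⟫_ℝ + P₁ y)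
    h₀ hdiv hB hG fun x => ?_
  have h01 : Torus.IsContDiff 1 U₀ := h₀.isContDiff (by simp)
  have h11 : Torus.IsContDiff 1 U₁ := h₁.isContDiff (by simp)
  have hi1 : Torus.IsContDiff 1 (fun y => ⟪U₀ y, U₁ y⟫_ℝ) := (h₀.inner h₁).isContDiff (by simp)
  have hP1 : Torus.IsContDiff 1 P₁ := hP.isContDiff (by simp)
  have hl := hlamb x (U₁ x)
  rw [fderiv_add_apply hi1 hP1, Torus.fderiv_inner_apply h01 h11, ← hlin x, inner_add_left,
    inner_add_left, Torus.inner_gradient_left]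
  simp only [Torus.convect] at hl ⊢
  linarith [real_inner_comm (U₀ x) (Torus.fderiv U₁ x (U₀ x))]

end

end Summit.AnomalousDissipation.AnomalousDissipation.Cruxes.SteadyStatesLoudBounded.BernoulliSuperlevelBlowdown
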